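import Literature.Barriers.RiemannHypothesis.BohrDenseValuesAPoints
import Literature.Barriers.RiemannHypothesis.BohrDenseValuesVoronin
import HarnessLib

/-!
# `BohrDenseValuesNarrow_holds`: the narrowed record of the barrier audit, unconditionally

Sibling of `Literature/Barriers/RiemannHypothesis/BohrDenseValues.lean` (barrier `BohrDenseValues`,
barrier audit 2026-08-16, D-0021). The audit appended to that file the narrowed record
`BohrDenseValuesNarrow` — the catalogued conjunction together with two sharper exclusions on every
line `1/2 < σ < 1` (visits of positive lower density to every non-empty open set,
`hasPosLowerDensity_mem_of_isOpen`; values on every open ray from the origin beyond every height,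
`exists_eq_ofReal_mul`) — proved there from the three vendored facts (`BohrDenseValuesNarrow_of`).
All three facts are discharged in the siblings (`BohrCourant1914_dense_holds` in
`BohrDenseValuesProofs.lean`; `Voronin1975_universality_holds`, `Titchmarsh1986_aPoints_holds` in
`BohrDenseValuesVoronin.lean`), so the narrowed record holds outright; this file records that
one-line discharge and the unconditional forms of the two new exclusions.

## References

* [Steuding2007] J. Steuding, *Value-Distribution of L-Functions*, LNM 1877, Springer 2007,
  §1.2 and Thm. 1.7 (PDF pp. 18–20 of the held copy).
* [Titchmarsh1986] E. C. Titchmarsh, *The Theory of the Riemann Zeta-function*, 2nd ed. (rev.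
  D. R. Heath-Brown), Oxford 1986, Thm. 11.9 and §11.10 (PDF pp. 222–227 of the held copy).
-/

noncomputable section

open Complex Set Metric MeasureTheory

namespace Literature.Barriers.RiemannHypothesis

/-- **Visits of positive lower density, unconditionally**: for `1/2 < σ < 1` and every non-empty
open `U ⊆ ℂ` the set `{t | ζ(σ + it) ∈ U}` has positive lower density
(`hasPosLowerDensity_mem_of_isOpen` fed with `Voronin1975_universality_holds`).
[cite: Steuding2007, Thm. 1.7] -/
theorem hasPosLowerDensity_mem_of_isOpen' {σ : ℝ} (hσ : 1 / 2 < σ) (hσ' : σ < 1) {U : Set ℂ}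
    (hU : IsOpen U) (hne : U.Nonempty) :
    HasPosLowerDensity {t : ℝ | riemannZeta (σ + t * I) ∈ U} :=
  hasPosLowerDensity_mem_of_isOpen Voronin1975_universality_holds hσ hσ' hU hne

/-- **Values on every open ray from the origin beyond every height, unconditionally**: for
`1/2 < σ < 1`, `a ≠ 0` and every `T₀` there are `t ≥ T₀` and `ρ > 0` with `ζ(σ + it) = ρ a`
(`exists_eq_ofReal_mul` fed with `Voronin1975_universality_holds`). [cite: Steuding2007, Thm. 1.7] -/
theorem exists_eq_ofReal_mul' {σ : ℝ} (hσ : 1 / 2 < σ) (hσ' : σ < 1) {a : ℂ} (ha : a ≠ 0)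
    (T₀ : ℝ) : ∃ t : ℝ, T₀ ≤ t ∧ ∃ ρ : ℝ, 0 < ρ ∧ riemannZeta (σ + t * I) = ρ * a :=
  exists_eq_ofReal_mul Voronin1975_universality_holds hσ hσ' ha T₀

/-- In particular `ζ(σ + it)` is a negative real number for arbitrarily large `t`, unconditionally
(`1/2 < σ < 1`). [cite: Steuding2007, Thm. 1.7] -/
theorem exists_neg_real_value' {σ : ℝ} (hσ : 1 / 2 < σ) (hσ' : σ < 1) (T₀ : ℝ) :
    ∃ t : ℝ, T₀ ≤ t ∧ (riemannZeta (σ + t * I)).im = 0 ∧ (riemannZeta (σ + t * I)).re < 0 :=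
  exists_neg_real_value Voronin1975_universality_holds hσ hσ' T₀

/-- **Discharge of the narrowed record `BohrDenseValuesNarrow`** (barrier audit of
`BohrDenseValues`, D-0021): from the discharged facts `BohrCourant1914_dense_holds`,
`Voronin1975_universality_holds`, `Titchmarsh1986_aPoints_holds` via `BohrDenseValuesNarrow_of`.
[cite: Steuding2007, §1.2, Thm. 1.7] [cite: Titchmarsh1986, Thm. 11.9 and §11.10] -/
theorem BohrDenseValuesNarrow_holds : BohrDenseValuesNarrow :=
  BohrDenseValuesNarrow_of BohrCourant1914_dense_holds Voronin1975_universality_holds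
    Titchmarsh1986_aPoints_holds

end Literature.Barriers.RiemannHypothesis
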